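import Mathlib
import Literature.Analysis.FluidPDE.EulerReynoldsLadderGluingIBP
import Literature.Analysis.FluidPDE.WholeSpaceIBP
import HarnessLib

/-!
# Ladder gluing of steady Euler–Reynolds subsolutions, IV: the blend of two layers

Analysis/FluidPDE support file (everything proved; no definitions, no named facts). Fourth of
the `EulerReynoldsLadderGluing*` files (tool T8 of the free-space sink completion, route
PointSink of the anomalous-dissipation summit, stub `stub_freeSpaceSinkCompletion`, crux
stmt-AnomalousDissipation-19035): the FINITE gluing step of the ladder. Two smooth unforced
Euler–Reynolds layers `(U₁, M₁)`, `(U₂, M₂)` (divergence-free velocity, row-divergence-free full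
stress) are interpolated on a blend shell by a cut-off `ζ` and CORRECTORS `z`, `T` solving
`div z = ⟪U₁ - U₂, ∇ζ⟫` and `Σⱼ ∂ⱼTᵢⱼ = -Σⱼ (M₁ - M₂)ᵢⱼ ∂ⱼζ` (Bogovskiĭ / symmetric
anti-divergence with compact support in the shell — NOT constructed here): the blends
`U = ζU₁ + (1-ζ)U₂ - z`, `M = ζM₁ + (1-ζ)M₂ + T` are again divergence free
(`divergence_blend_eq_zero`, `sum_fderiv_blend_eq_zero`), pointwise. These identities, applied
near each point, give the hypotheses "`U`, `M` are `C¹` and divergence free on `{r₀ < |x|}`" of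
parts II–III (`EulerReynoldsLadderGluingLimit/Div`). Also recorded: the convexity defect of the
velocity blend is positive semidefinite (`posSemidef_convexDefect`), so blending two layers with
positive semidefinite Reynolds defects keeps the defect positive semidefinite
(`posSemidef_blend_defect`), and a symmetric matrix is absorbed by an isotropic top-up of size its
`ℓ¹` entry norm (`posSemidef_add_diagonal_of_abs_sum_le`) — the strictness/`L¹` bookkeeping of the
correctors `T`, `z ⊗ U` in the recorded stress.

## Mathlib / tree search

Tree: `divergence_smul_apply` (`WholeSpaceIBP`), `MollifiedEulerCone.posSemidef_covariance`;
Mathlib: `Matrix.PosSemidef.add/.smul`, `fderiv_fun_mul/add/sub`. No blend lemma exists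
(`lean search 'blend|convexDefect'`, 2026-08-17).

## References

* C. De Lellis, L. Székelyhidi Jr., Arch. Ration. Mech. Anal. 195 (2010) 225–260, §2 and §4
  (subsolutions; gluing by partitions of unity). [DeLellisSzekelyhidi2010]
* G. P. Galdi, *An Introduction to the Mathematical Theory of the Navier–Stokes Equations*
  (2011), §III.3 (the corrector equation `div z = g`). [Galdi2011]
-/

noncomputable section

open MeasureTheory Filter Topology Set Metric Function
open scoped RealInnerProductSpace ContDiff

namespace Literature.Analysis.FluidPDE

namespace EulerReynoldsLadder

/-! ### Divergence of sums and differences at a point -/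

/-- `div (u + v) = div u + div v` at a point of differentiability. [folklore] -/
theorem divergence_add_apply {u v : EuclideanSpace ℝ (Fin 3) → EuclideanSpace ℝ (Fin 3)}
    {x : EuclideanSpace ℝ (Fin 3)} (hu : DifferentiableAt ℝ u x) (hv : DifferentiableAt ℝ v x) :
    VectorCalculus.divergence (fun y => u y + v y) x =
      VectorCalculus.divergence u x + VectorCalculus.divergence v x := by
  unfold VectorCalculus.divergence
  rw [fderiv_fun_add hu hv, ContinuousLinearMap.toLinearMap_add, map_add]

/-- `div (u - v) = div u - div v` at a point of differentiability. [folklore] -/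
theorem divergence_sub_apply {u v : EuclideanSpace ℝ (Fin 3) → EuclideanSpace ℝ (Fin 3)}
    {x : EuclideanSpace ℝ (Fin 3)} (hu : DifferentiableAt ℝ u x) (hv : DifferentiableAt ℝ v x) :
    VectorCalculus.divergence (fun y => u y - v y) x =
      VectorCalculus.divergence u x - VectorCalculus.divergence v x := by
  unfold VectorCalculus.divergence
  rw [fderiv_fun_sub hu hv, ContinuousLinearMap.toLinearMap_sub, map_sub]

/-! ### The velocity blend -/

/-- **The velocity blend is divergence free.** At a point `x` where `U₁, U₂, z` are
differentiable and `ζ` is differentiable: if `div U₁ = div U₂ = 0` and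
`div z = ⟪U₁ - U₂, ∇ζ⟫` at `x`, then `div (ζU₁ + (1-ζ)U₂ - z) (x) = 0`. [folklore] -/
theorem divergence_blend_eq_zero {U₁ U₂ z : EuclideanSpace ℝ (Fin 3) → EuclideanSpace ℝ (Fin 3)}
    {ζ : EuclideanSpace ℝ (Fin 3) → ℝ} {x : EuclideanSpace ℝ (Fin 3)}
    (hU₁ : DifferentiableAt ℝ U₁ x) (hU₂ : DifferentiableAt ℝ U₂ x) (hz : DifferentiableAt ℝ z x)
    (hζ : DifferentiableAt ℝ ζ x)
    (hdiv₁ : VectorCalculus.divergence U₁ x = 0) (hdiv₂ : VectorCalculus.divergence U₂ x = 0)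
    (hdivz : VectorCalculus.divergence z x = ⟪U₁ x - U₂ x, gradient ζ x⟫) :
    VectorCalculus.divergence (fun y => ζ y • U₁ y + (1 - ζ y) • U₂ y - z y) x = 0 := by
  have hζ' : DifferentiableAt ℝ (fun y => 1 - ζ y) x := (differentiableAt_const _).sub hζ
  have h1 : DifferentiableAt ℝ (fun y => ζ y • U₁ y) x := hζ.smul hU₁
  have h2 : DifferentiableAt ℝ (fun y => (1 - ζ y) • U₂ y) x := hζ'.smul hU₂
  have h12 : DifferentiableAt ℝ (fun y => ζ y • U₁ y + (1 - ζ y) • U₂ y) x := h1.add h2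
  rw [divergence_sub_apply h12 hz, divergence_add_apply h1 h2,
    divergence_smul_apply hζ hU₁, divergence_smul_apply hζ' hU₂, hdiv₁, hdiv₂, hdivz]
  have hgrad : gradient (fun y => 1 - ζ y) x = -gradient ζ x := by
    rw [gradient, gradient, fderiv_fun_sub (differentiableAt_const _) hζ, fderiv_fun_const]
    simp
  rw [hgrad, inner_sub_left, inner_neg_right]
  ring

/-! ### The stress blend -/

/-- **The stress blend is row-divergence free.** At a point `x` where the entries of `M₁`,
`M₂`, `T` and the cut-off `ζ` are differentiable: if `Σⱼ ∂ⱼ(M₁)ᵢⱼ = Σⱼ ∂ⱼ(M₂)ᵢⱼ = 0` and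
`Σⱼ ∂ⱼTᵢⱼ = -Σⱼ ((M₁)ᵢⱼ - (M₂)ᵢⱼ) ∂ⱼζ` at `x`, then the blend
`M = ζM₁ + (1-ζ)M₂ + T` has `Σⱼ ∂ⱼMᵢⱼ(x) = 0`. [folklore] -/
theorem sum_fderiv_blend_eq_zero {M₁ M₂ T : EuclideanSpace ℝ (Fin 3) → Fin 3 → Fin 3 → ℝ}
    {ζ : EuclideanSpace ℝ (Fin 3) → ℝ} {x : EuclideanSpace ℝ (Fin 3)} {i : Fin 3}
    (hM₁ : ∀ j, DifferentiableAt ℝ (fun y => M₁ y i j) x)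
    (hM₂ : ∀ j, DifferentiableAt ℝ (fun y => M₂ y i j) x)
    (hT : ∀ j, DifferentiableAt ℝ (fun y => T y i j) x) (hζ : DifferentiableAt ℝ ζ x)
    (hdiv₁ : ∑ j, fderiv ℝ (fun y => M₁ y i j) x (EuclideanSpace.single j 1) = 0)
    (hdiv₂ : ∑ j, fderiv ℝ (fun y => M₂ y i j) x (EuclideanSpace.single j 1) = 0)
    (hdivT : ∑ j, fderiv ℝ (fun y => T y i j) x (EuclideanSpace.single j 1) =
      -∑ j, (M₁ x i j - M₂ x i j) * fderiv ℝ ζ x (EuclideanSpace.single j 1)) :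
    ∑ j, fderiv ℝ (fun y => ζ y * M₁ y i j + (1 - ζ y) * M₂ y i j + T y i j) x
      (EuclideanSpace.single j 1) = 0 := by
  have hζ' : DifferentiableAt ℝ (fun y => 1 - ζ y) x := (differentiableAt_const _).sub hζ
  have hterm : ∀ j, fderiv ℝ (fun y => ζ y * M₁ y i j + (1 - ζ y) * M₂ y i j + T y i j) x
      (EuclideanSpace.single j 1) =
      (fderiv ℝ ζ x (EuclideanSpace.single j 1) * M₁ x i j +
        ζ x * fderiv ℝ (fun y => M₁ y i j) x (EuclideanSpace.single j 1)) +
      (-fderiv ℝ ζ x (EuclideanSpace.single j 1) * M₂ x i j +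
        (1 - ζ x) * fderiv ℝ (fun y => M₂ y i j) x (EuclideanSpace.single j 1)) +
      fderiv ℝ (fun y => T y i j) x (EuclideanSpace.single j 1) := by
    intro j
    have h1 : DifferentiableAt ℝ (fun y => ζ y * M₁ y i j) x := hζ.mul (hM₁ j)
    have h2 : DifferentiableAt ℝ (fun y => (1 - ζ y) * M₂ y i j) x := hζ'.mul (hM₂ j)
    have h12 : DifferentiableAt ℝ (fun y => ζ y * M₁ y i j + (1 - ζ y) * M₂ y i j) x :=
      h1.add h2
    rw [fderiv_fun_add h12 (hT j), fderiv_fun_add h1 h2, fderiv_fun_mul hζ (hM₁ j),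
      fderiv_fun_mul hζ' (hM₂ j), fderiv_fun_sub (differentiableAt_const _) hζ, fderiv_fun_const]
    simp only [add_apply, smul_apply, smul_eq_mul, Pi.zero_apply, zero_sub, neg_apply]
    ring
  simp_rw [hterm]
  rw [show (∑ j, (fderiv ℝ ζ x (EuclideanSpace.single j 1) * M₁ x i j +
        ζ x * fderiv ℝ (fun y => M₁ y i j) x (EuclideanSpace.single j 1) +
      (-fderiv ℝ ζ x (EuclideanSpace.single j 1) * M₂ x i j +
        (1 - ζ x) * fderiv ℝ (fun y => M₂ y i j) x (EuclideanSpace.single j 1)) +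
      fderiv ℝ (fun y => T y i j) x (EuclideanSpace.single j 1))) =
      ∑ j, (M₁ x i j - M₂ x i j) * fderiv ℝ ζ x (EuclideanSpace.single j 1) +
        ζ x * ∑ j, fderiv ℝ (fun y => M₁ y i j) x (EuclideanSpace.single j 1) +
        (1 - ζ x) * ∑ j, fderiv ℝ (fun y => M₂ y i j) x (EuclideanSpace.single j 1) +
        ∑ j, fderiv ℝ (fun y => T y i j) x (EuclideanSpace.single j 1) from by
      rw [Finset.mul_sum, Finset.mul_sum, ← Finset.sum_add_distrib, ← Finset.sum_add_distrib,
        ← Finset.sum_add_distrib]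
      exact Finset.sum_congr rfl fun j _ => by ring,
    hdiv₁, hdiv₂, hdivT]
  ring

/-! ### Positivity bookkeeping of the blend -/

/-- **The convexity defect of a two-point average is positive semidefinite**: for
`0 ≤ ζ ≤ 1` and vectors `u, v`, the matrix `ζ u⊗u + (1-ζ) v⊗v - w⊗w`, `w = ζu + (1-ζ)v`, equals
`ζ(1-ζ) (u-v)⊗(u-v) ⪰ 0`. [folklore] -/
theorem posSemidef_convexDefect (u v : EuclideanSpace ℝ (Fin 3)) {ζ : ℝ} (h0 : 0 ≤ ζ)
    (h1 : ζ ≤ 1) :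
    (Matrix.of fun i j : Fin 3 =>
      ζ * (u i * u j) + (1 - ζ) * (v i * v j) -
        (ζ * u i + (1 - ζ) * v i) * (ζ * u j + (1 - ζ) * v j)).PosSemidef := by
  have hkey : (Matrix.of fun i j : Fin 3 =>
      ζ * (u i * u j) + (1 - ζ) * (v i * v j) -
        (ζ * u i + (1 - ζ) * v i) * (ζ * u j + (1 - ζ) * v j)) =
      (ζ * (1 - ζ)) • Matrix.vecMulVec (fun i => u i - v i) (fun j => u j - v j) := by
    ext i j
    simp only [Matrix.of_apply, Matrix.smul_apply, Matrix.vecMulVec_apply, smul_eq_mul]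
    ring
  rw [hkey]
  have h := Matrix.posSemidef_vecMulVec_self_star (R := ℝ) (fun i : Fin 3 => u i - v i)
  simp only [star_trivial] at h
  exact h.smul (mul_nonneg h0 (by linarith))

/-- **Blending keeps the Reynolds defect positive semidefinite.** If `S₁ - u⊗u ⪰ 0`,
`S₂ - v⊗v ⪰ 0` and `0 ≤ ζ ≤ 1`, then `ζS₁ + (1-ζ)S₂ - w⊗w ⪰ 0` for the blended velocity
`w = ζu + (1-ζ)v` (sum of the blended defects and the convexity defect). [folklore] -/
theorem posSemidef_blend_defect {S₁ S₂ : Fin 3 → Fin 3 → ℝ} (u v : EuclideanSpace ℝ (Fin 3))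
    {ζ : ℝ} (h0 : 0 ≤ ζ) (h1 : ζ ≤ 1)
    (hA₁ : (Matrix.of fun i j : Fin 3 => S₁ i j - u i * u j).PosSemidef)
    (hA₂ : (Matrix.of fun i j : Fin 3 => S₂ i j - v i * v j).PosSemidef) :
    (Matrix.of fun i j : Fin 3 => ζ * S₁ i j + (1 - ζ) * S₂ i j -
      (ζ * u i + (1 - ζ) * v i) * (ζ * u j + (1 - ζ) * v j)).PosSemidef := by
  have hkey : (Matrix.of fun i j : Fin 3 => ζ * S₁ i j + (1 - ζ) * S₂ i j -
      (ζ * u i + (1 - ζ) * v i) * (ζ * u j + (1 - ζ) * v j)) =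
      ζ • (Matrix.of fun i j : Fin 3 => S₁ i j - u i * u j) +
        (1 - ζ) • (Matrix.of fun i j : Fin 3 => S₂ i j - v i * v j) +
        Matrix.of (fun i j : Fin 3 => ζ * (u i * u j) + (1 - ζ) * (v i * v j) -
          (ζ * u i + (1 - ζ) * v i) * (ζ * u j + (1 - ζ) * v j)) := by
    ext i j
    simp only [Matrix.of_apply, Matrix.add_apply, Matrix.smul_apply, smul_eq_mul]
    ring
  rw [hkey]
  exact ((hA₁.smul h0).add (hA₂.smul (by linarith))).add (posSemidef_convexDefect u v h0 h1)

/-- **Isotropic top-up of a symmetric matrix.** If `B` is symmetric with `Σᵢⱼ |Bᵢⱼ| ≤ β`, then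
`B + β·Id ⪰ 0` (`xᵀBx ≥ -Σ|Bᵢⱼ||xᵢ||xⱼ| ≥ -β |x|²`). In the ladder the correctors `T` (and the
cross terms `z⊗U + U⊗z - z⊗z`) are absorbed into the recorded stress by such a top-up, whose
`L¹` size is the `L¹` size of the correctors. [folklore] -/
theorem posSemidef_add_diagonal_of_abs_sum_le {B : Fin 3 → Fin 3 → ℝ} {β : ℝ}
    (hsymm : ∀ i j, B i j = B j i) (hβ : ∑ i, ∑ j, |B i j| ≤ β) :
    (Matrix.of fun i j : Fin 3 => B i j + if i = j then β else 0).PosSemidef := by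
  refine Matrix.PosSemidef.of_dotProduct_mulVec_nonneg ?_ fun x => ?_
  · ext i j
    simp only [Matrix.conjTranspose_apply, Matrix.of_apply, star_trivial]
    rw [hsymm i j]
    by_cases h : i = j
    · subst h; rfl
    · simp [h, Ne.symm h]
  · -- `xᵀ(B + βI)x = Σᵢⱼ Bᵢⱼxᵢxⱼ + β|x|² ≥ 0`
    have hq : star x ⬝ᵥ (Matrix.of fun i j : Fin 3 => B i j + if i = j then β else 0).mulVec x =
        ∑ i, ∑ j, B i j * (x i * x j) + β * ∑ i, x i * x i := by
      simp only [star_trivial, dotProduct, Matrix.mulVec, Matrix.of_apply]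
      rw [Finset.mul_sum, ← Finset.sum_add_distrib]
      refine Finset.sum_congr rfl fun i _ => ?_
      rw [show (∑ j, (B i j + if i = j then β else 0) * x j) =
          ∑ j, (B i j * x j + if i = j then β * x j else 0) from
        Finset.sum_congr rfl fun j _ => by split_ifs <;> ring]
      rw [Finset.sum_add_distrib, Finset.sum_ite_eq, if_pos (Finset.mem_univ _), mul_add,
        Finset.mul_sum]
      congr 1
      · exact Finset.sum_congr rfl fun j _ => by ring
      · ring
    rw [hq]
    -- each `|Bᵢⱼ xᵢ xⱼ| ≤ |Bᵢⱼ| (xᵢ² + xⱼ²)/2 ≤ |Bᵢⱼ| |x|²`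
    have hsq : ∀ i, x i * x i ≤ ∑ k, x k * x k := fun i =>
      Finset.single_le_sum (f := fun k => x k * x k) (fun k _ => mul_self_nonneg (x k))
        (Finset.mem_univ i)
    have hterm : ∀ i j, -(|B i j| * ∑ k, x k * x k) ≤ B i j * (x i * x j) := by
      intro i j
      have h1 : |x i * x j| ≤ ∑ k, x k * x k := by
        rw [abs_mul]
        nlinarith [hsq i, hsq j, abs_nonneg (x i), abs_nonneg (x j), abs_mul_abs_self (x i),
          abs_mul_abs_self (x j), sq_nonneg (|x i| - |x j|)]
      have h2 : |B i j * (x i * x j)| ≤ |B i j| * ∑ k, x k * x k := by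
        rw [abs_mul]
        exact mul_le_mul_of_nonneg_left h1 (abs_nonneg _)
      linarith [neg_abs_le (B i j * (x i * x j))]
    have hsum : -(∑ i, ∑ j, |B i j|) * ∑ k, x k * x k ≤ ∑ i, ∑ j, B i j * (x i * x j) := by
      rw [neg_mul, Finset.sum_mul, ← Finset.sum_neg_distrib]
      refine Finset.sum_le_sum fun i _ => ?_
      rw [Finset.sum_mul, ← Finset.sum_neg_distrib]
      exact Finset.sum_le_sum fun j _ => hterm i j
    have hx0 : 0 ≤ ∑ k, x k * x k := Finset.sum_nonneg fun k _ => mul_self_nonneg (x k)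
    nlinarith [mul_le_mul_of_nonneg_right hβ hx0]

end EulerReynoldsLadder

end Literature.Analysis.FluidPDE

end
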